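import Summits.BirchSwinnertonDyer.BirchSwinnertonDyer.Theses.FrozenTwin
import Summits.BirchSwinnertonDyer.BirchSwinnertonDyer.Theses.ToricShedding
import Summits.BirchSwinnertonDyer.BirchSwinnertonDyer.Theses.DefiniteTheta
import Summits.BirchSwinnertonDyer.BirchSwinnertonDyer.Theses.SelmerRank
import Summits.BirchSwinnertonDyer.BirchSwinnertonDyer.Cruxes.UBPotentiallyGood.Position
import Summits.BirchSwinnertonDyer.BirchSwinnertonDyer.Cruxes.UBPotentiallyGood.NonVacuity
import Summits.BirchSwinnertonDyer.BirchSwinnertonDyer.Theorems.PGSelmerBSD.Negative.AdmissiblePrimeFalse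
import Summits.BirchSwinnertonDyer.BirchSwinnertonDyer.Theorems.FrozenTwinSerrePrimeSupply
import Literature.NumberTheory.EllipticCurves.BSDSelmerParityDokchitserProofs
import Literature.NumberTheory.EllipticCurves.BSDSelmerCMPConverseKLevelProofs

/-!
# Disproof of `UBPotentiallyGood` (crux `stmt-BirchSwinnertonDyer-15878`) — findings: NO KILL.
# Faithful formalisation; no hypothesis is load-bearing for truth (crux ⇐ BSD-rank ∧ Ш[p^∞]-finite);
# VACUOUS on the CM sub-sector (⇔ its non-CM part); a counterexample needs r_an ≥ 2 and
# corank_p ≥ r_an + 2 ≥ 4 (mod GZK + p-parity); junk surface closed; one false strengthening.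

Standing crux disprover `refuter-cdisprove-stmt-BirchSwinnertonDyer-15878-0` (cycle 1, 2026-08-17),
route `FrozenTwin` (the decl is shared byte-for-byte with `ToricShedding.UBPotentiallyGood` (rank 5)
and `DefiniteTheta.UBPotentiallyGood` (rank 4), §0). Prose only in docstrings; every theorem below
is kernel-checked (`lean check` rc 0, 0 `sorry`). Inputs honoured and NOT redone: the crux-attack
refuter's `Position.lean` (P1–P5: `S ∧ ShaPFinite → C`, `SelmerRankUB → C`, `C → rank ≤ r_an` on the
non-CM sector, the GZK slice, bare ⇒ C) and `NonVacuity.lean` (`hypotheses_inhabited`, witness a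
global minimal model of `W121 = 11a3 ⊗ χ₋₁₁`, `j = −4096/11`), both imported; rattack's kit job
j024435 (no `ord_T L_p > r_an` for N ≤ 20000); `STRATEGY-CENSUS.md`; `Lines/birth.lean`,
`Lines/kurihara_depth.lean`; `ledger negatives --problem BirchSwinnertonDyer` (1 entry, 15532
TamePinch/32a2 — its witness is REUSED in §1 and §5 through the landed
`Theorems/TamePinch/Negative/CMQuarticImage` and `Theorems/PGSelmerBSD/Negative/AdmissiblePrimeFalse`).

The crux `C`: for `W/ℚ` elliptic, globally minimal, with NO prime of multiplicative reduction, and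
every prime `p ≥ 5` of good ordinary reduction with `ρ̄_{W,p}` onto:
`corank_{ℤ_p} Sel_{p^∞}(W/ℚ) ≤ ord_{s=1} L(W,s)`.

## Findings (section ↦ theorems)

0. READ-BACK. `ubPotentiallyGood_iff` (`Iff.rfl`); the three route copies are one statement
   (`toricShedding_iff`, `definiteTheta_iff`); dropping the sector gives `SelmerRank.SelmerRankUB`
   verbatim (`withoutSector_iff_selmerRankUB`). Symbols: `selmerCorank = zpCorank Sel_{p^∞}` with
   `zpCorank A p = dim A[p] − dim A/pA` (ℕ-subtraction, `finrank`-junk 0) made honest by the PROVED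
   identity `corank Sel = rank + corank Ш[p^∞]` (`selmerCorank_eq_mordellWeilRank_add_holds`);
   `analyticRank = analyticOrderNatAt entireLFunction 1`; `frobeniusTrace = p + 1 − #W̃(𝔽_p)` on the
   global minimal model; `HasGood/MultiplicativeReductionAtPrime` = Mathlib reduction type of the
   `ℤ_p`-minimal model (model-independent); `HasSurjectiveModNGaloisRep ↑p` = `ρ̄_{W,p}` onto.
   Quantifier order matches the informal text. The Lean sector "no multiplicative prime" is WIDER
   than the docstring's "integral j" (it contains additive potentially-multiplicative curves such as
   `W121`, `‖j‖₁₁ = 11`; checked: `sector_wider_than_integral_j`): harmless for truth (§2), recorded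
   for the planner.
1. VACUITY. Not vacuous (`hypotheses_inhabited`, imported). But VACUOUS ON EVERY CM CURVE:
   a CM curve has no prime `p > 3` of good ordinary reduction with `ρ̄` onto (tree theorems
   `not_hasSurjectiveModNGaloisRep_of_hasCM_of_not_dvd_frobeniusTrace`,
   `not_hasCM_of_hasSurjectiveModNGaloisRep_of_five_le`; Serre 1972 §4.5), so
   `C ⇔ C ∧ ¬HasCM` (`ubPotentiallyGood_iff_nonCM`), and the CM sub-sector is non-empty
   (`sector_meets_CM`, 32a2; `conclusion_vacuous_at_thirtyTwoA2`). Consequence: unlike the sibling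
   crux `PGSelmerBSD` (17810), lines for THIS crux need no CM branch, and the CM crux
   `SelmerRankCM` (18086) is logically disjoint from it.
2. LOAD-BEARING ANALYSIS (a). Six weakenings `UBPotentiallyGoodWithout{Minimal,Sector,Five,Good,
   Ordinary,Surjective}` and the hypothesis-free `UBBare`; sandwich `UBBare → Without<H> → C` and
   `BSD ∧ SelmerRankShaPFinite → UBBare` (`ubBare_of_bsd_of_shaPFinite`), hence
   `¬ Without<H> → ¬ (BSD ∧ SelmerRankShaPFinite)` (`not_bsd_and_shaPFinite_of_not_without`): NO
   `_false_without_<H>` theorem exists for any of the six short of refuting BSD-rank or exhibiting an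
   infinite `Ш[p^∞]`. The hypotheses select TOOLS (Kato/Heegner need good ordinary big-image `p`),
   not truth. Converse bookkeeping: `C ∧ S ⇒ corank Ш[p^∞] = 0` at admissible `(W,p)` (P1'') and
   `C ⇒ rank ≤ r_an` on the non-CM sector (P3, Serre supply `frozenTwin_serrePrimeSupply_proof`).
3. TIGHTNESS AND COUNTEREXAMPLE SHAPE. The bound is attained wherever BSD-rank holds
   (`analyticRank_le_selmerCorank_of_rank_eq`: `rank = r_an ⇒ r_an ≤ corank_p`, unconditional; with `C`,
   equality `selmerCorank_eq_of_ub_of_rank_eq`). Unconditionally a violating `(W,p)` has `rank > r_an` or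
   `corank Ш(W)[p^∞] ≥ 1` (`cex_dichotomy`); mod Gross–Zagier–Kolyvagin + `p`-parity (tree facts as
   hypotheses) it has `r_an ≥ 2`, `corank_p ≥ r_an + 2 ≥ 4` (`cex_shape`), and if `rank ≤ r_an` there
   (true throughout the LMFDB range) then `corank Ш(W)[p^∞] ≥ 2` (`two_le_shaCorank_of_rank_le`);
   `exists_witness_of_not` packages the Σ-shape of `¬C`; `ubPotentiallyGood_iff_core`: mod GZK the
   crux IS its `r_an ≥ 2`, non-CM slice. No construction, heuristic or numerical signature of such a
   curve exists; Kato gives only `corank_p ≤ ord_T L_p`, so a kit search can CONFIRM instances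
   (rattack j024435) but never refute — no job submitted this cycle.
4. JUNK AUDIT. Selmer side: junk only LOWERS the corank (`zpCorank_le_finrank_torsionBy`,
   `zpCorank_eq_zero_of_not_finite`) — it helps `C`. Analytic side: junk LOWERS `r_an` to `0`
   (`analyticRank_eq_zero_of_not_analyticAt`, `analyticRank_eq_zero_of_eventuallyEq_zero`) — it works
   AGAINST `C`, but only if `L(W,s)` had no entire continuation or vanished identically near `1`,
   i.e. only if modularity (BCDT 2001, tree fact `hasEntireLFunction_rat`) or `a₁ = 1`
   (`entireLFunction_not_eventuallyEq_zero`) failed; under them `analyticRank` is the honest order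
   (`analyticRank_honest`). So no junk lever for the refuter, and the prover MUST invoke both facts.
   Mathlib's `LFunction` uses the minimal model at each prime and Euler factor `1` at additive primes
   — faithful on the sector.
5. STRENGTHENINGS (c). FALSE (small model 32a2): "every sector curve HAS an admissible prime"
   (`strengthening_exists_admissible_false`) — so the route's assembly cannot feed CM sector curves
   through `C` (it does not: `closes` routes CM curves to `SelmerRankCM`). NOT refutable here (all
   implied by `BSD ∧ SelmerRankShaPFinite`): `UBBare`; equality `corank_p = r_an` (= `C ∧ SelmerRankLB`
   on the sector); all primes `p` (drop `5 ≤ p`, ordinarity, surjectivity); number-field versions.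
   FALSE IN PRINT but not Lean-checkable today: the mod-`p` version `dim_{𝔽_p} Sel_p(W) ≤ r_an`
   (curves with `Ш(W)[p] ≠ 0`, `rank = r_an`, big image: Fisher's visible elements of order 5/7);
   the strict version `corank_p < r_an` (dies at any sector curve with certified `r_an = 0`, e.g. a
   global minimal model of `W121`' s isogeny class mates of analytic rank 0 — needs a certified
   `L(E,1) ≠ 0` + modularity in Lean, not in tree: recorded as the near-miss `strict_version_false`).
6. `-- Targets`: none served (payload.targets = [], no line picked). `-- Lines`: pre-attack notes on
   `Lines/birth.lean` and `Lines/kurihara_depth.lean` in `lineNotes`.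

## Landed (Negative lane, importable; cite instead of this work-file)
* p172395 ACCEPTED — `Summits/BirchSwinnertonDyer/BirchSwinnertonDyer/Theorems/UBPotentiallyGood/Negative/CounterexampleShape.lean`
  (`Summit.BirchSwinnertonDyer.BirchSwinnertonDyer.Theorems.UBPotentiallyGoodNegative.{hypotheses_unsatisfiable_of_hasCM,
  strengthening_exists_admissible_false, not_summit_and_shaPFinite_of_not, exists_infinite_sha_of_summit_of_not,
  cex_dichotomy, cex_shape, two_le_shaCorank_of_rank_le, exists_witness_of_not,
  analyticRank_eq_zero_of_not_analyticAt, analyticRank_eq_zero_of_eventuallyEq_zero}`; axioms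
  `propext/Classical.choice/Quot.sound`). The tree already had
  `Literature.NumberTheory.EllipticCurves.not_hasCM_of_hasSurjectiveModNGaloisRep_of_five_le`
  (every pair meeting the hypotheses is non-CM), which is the one-line form of §1.
The copies below (namespace `…Cruxes.UBPotentiallyGood.Disproof`) keep this work-file self-contained.

## Why it resists (for provers and planners)
`C` is the potentially-good, big-image-ordinary sector of Selmer-rank BSD's upper half: it follows
from BSD-rank ∧ `Ш[p^∞]`-finite, both sides are honest non-computable invariants, and every junk
convention either helps `C` or is excluded by modularity. It is a THEOREM for `corank_p ≤ 3`
(Kato `r_an = 0`; GZK `r_an = 1`; `p`-parity lifts to `corank ≤ 3` given `r_an ≥ 2` forces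
`corank ∉ {r_an+1}`), and OPEN exactly from `corank_p ≥ 4`, `r_an ≥ 2` — where no Selmer class is
known to come out of higher-order vanishing and no infinite `Ш[p^∞]` is known to exist.
-/

set_option linter.dupNamespace false

noncomputable section

open scoped Classical Topology AddSubgroup

namespace Summit.BirchSwinnertonDyer.BirchSwinnertonDyer.Cruxes.UBPotentiallyGood.Disproof

open Filter
open Summit.BirchSwinnertonDyer.BirchSwinnertonDyer.Theses
open Summit.BirchSwinnertonDyer.BirchSwinnertonDyer.Theorems
open Summit.BirchSwinnertonDyer.BirchSwinnertonDyer.Cruxes.UBPotentiallyGood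
open Literature.NumberTheory.EllipticCurves WeierstrassCurve

/-! ### 0. Read-back -/

/-- The crux, by name (same abbreviation as `Position.lean`). [folklore] -/
abbrev C : Prop := FrozenTwin.UBPotentiallyGood

/-- The item is definitionally its verbatim ledger signature. [folklore] -/
theorem ubPotentiallyGood_iff :
    C ↔ ∀ (W : WeierstrassCurve ℚ) [W.IsElliptic] [W.IsGloballyMinimal],
      (¬ ∃ (q : ℕ) (_ : Fact q.Prime), W.HasMultiplicativeReductionAtPrime q) →
        ∀ (p : ℕ) [Fact p.Prime], 5 ≤ p → W.HasGoodReductionAtPrime p →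
          ¬ (p : ℤ) ∣ W.frobeniusTrace p → W.HasSurjectiveModNGaloisRep p →
            W.selmerCorank p ≤ W.analyticRank :=
  Iff.rfl

/-- Route `ToricShedding`'s copy (rank 5) is the same statement. [folklore] -/
theorem toricShedding_iff : ToricShedding.UBPotentiallyGood ↔ C := Iff.rfl

/-- Route `DefiniteTheta`'s copy (rank 4) is the same statement. [folklore] -/
theorem definiteTheta_iff : DefiniteTheta.UBPotentiallyGood ↔ C := Iff.rfl

/-! ### 1. Vacuity: inhabited, but vacuous on every CM curve -/

/-- NOT vacuous (imported from `NonVacuity.lean`, kernel-checked there, axioms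
`propext/Classical.choice/Quot.sound`): a global minimal model of `W121 = [0,−1,1,−40,−221]`
(`j = −4096/11`, non-CM, all bad primes additive) with a Serre prime. [folklore] -/
theorem hypotheses_inhabited' :
    ∃ (W : WeierstrassCurve ℚ) (_ : W.IsElliptic) (_ : W.IsGloballyMinimal),
      (¬ ∃ (q : ℕ) (_ : Fact q.Prime), W.HasMultiplicativeReductionAtPrime q) ∧
      ∃ (p : ℕ) (_ : Fact p.Prime), 5 ≤ p ∧ W.HasGoodReductionAtPrime p ∧
        ¬ (p : ℤ) ∣ W.frobeniusTrace p ∧ W.HasSurjectiveModNGaloisRep p :=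
  CruxAttack.hypotheses_inhabited

/-- **On a CM curve the hypothesis block is unsatisfiable**: no prime `p ≥ 5` of good ordinary
reduction has `ρ̄_{W,p}` onto (Serre 1972 §4.5, tree theorem
`not_hasSurjectiveModNGaloisRep_of_hasCM_of_not_dvd_frobeniusTrace`). [cite: Serre1972, §4.5] -/
theorem hypotheses_unsatisfiable_of_hasCM (W : WeierstrassCurve ℚ) [W.IsElliptic]
    [W.IsGloballyMinimal] (hCM : W.HasCM) (p : ℕ) [Fact p.Prime] (h5 : 5 ≤ p)
    (hgood : W.HasGoodReductionAtPrime p) (hord : ¬ (p : ℤ) ∣ W.frobeniusTrace p) :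
    ¬ W.HasSurjectiveModNGaloisRep p :=
  not_hasSurjectiveModNGaloisRep_of_hasCM_of_not_dvd_frobeniusTrace W hCM p (by omega) hgood hord

/-- The crux with the hypothesis `¬ W.HasCM` ADDED (its non-CM part). [folklore] -/
def UBPotentiallyGoodNonCM : Prop :=
  ∀ (W : WeierstrassCurve ℚ) [W.IsElliptic] [W.IsGloballyMinimal], ¬ W.HasCM →
    (¬ ∃ (q : ℕ) (_ : Fact q.Prime), W.HasMultiplicativeReductionAtPrime q) →
      ∀ (p : ℕ) [Fact p.Prime], 5 ≤ p → W.HasGoodReductionAtPrime p →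
        ¬ (p : ℤ) ∣ W.frobeniusTrace p → W.HasSurjectiveModNGaloisRep p →
          W.selmerCorank p ≤ W.analyticRank

/-- **`C` is equivalent to its non-CM part**: on CM curves it holds vacuously. So (unlike the sibling
crux `PGSelmerBSD`) no line for this crux needs a CM branch, and `¬ W.HasCM` is a free hypothesis for
provers. [cite: Serre1972, §4.5] -/
theorem ubPotentiallyGood_iff_nonCM : C ↔ UBPotentiallyGoodNonCM := by
  constructor
  · exact fun hC W _ _ _ hpg p _ h5 hg ho hs => hC W hpg p h5 hg ho hs
  · intro h W _ _ hpg p _ h5 hg ho hs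
    by_cases hCM : W.HasCM
    · exact absurd hs (hypotheses_unsatisfiable_of_hasCM W hCM p h5 hg ho)
    · exact h W hCM hpg p h5 hg ho hs

/-- The CM sub-sector is non-empty: `32a2 : y² = x³ − x` (`j = 1728`) is elliptic, globally minimal, in
the sector and CM (landed, `PGSelmerBSDNegative.sector_meets_CM`). So the vacuity of §1 is about real
curves, not an empty family. [folklore] -/
theorem sector_meets_CM :
    ∃ (W : WeierstrassCurve ℚ) (_ : W.IsElliptic) (_ : W.IsGloballyMinimal),
      (¬ ∃ (q : ℕ) (_ : Fact q.Prime), W.HasMultiplicativeReductionAtPrime q) ∧ W.HasCM :=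
  PGSelmerBSDNegative.sector_meets_CM

/-- `32a2` is elliptic (landed `isElliptic_quartic`). [folklore] -/
instance isElliptic_thirtyTwoA2 : (⟨0, 0, 0, -1, 0⟩ : WeierstrassCurve ℚ).IsElliptic :=
  isElliptic_quartic (by norm_num)

/-- `32a2` is globally minimal (landed `tamePinch_isGloballyMinimal_thirtyTwoA2`). [folklore] -/
instance isGloballyMinimal_thirtyTwoA2 : (⟨0, 0, 0, -1, 0⟩ : WeierstrassCurve ℚ).IsGloballyMinimal :=
  tamePinch_isGloballyMinimal_thirtyTwoA2

/-- **The conclusion of `C` at `32a2` is reached vacuously at every `p ≥ 5`** (indeed at every odd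
`p`, with no reduction hypothesis): `ρ̄_{32a2,p}` is never onto
(`tamePinch_not_hasSurjectiveModNGaloisRep_quartic`). [cite: Serre1972, §4.5] -/
theorem conclusion_vacuous_at_thirtyTwoA2 (p : ℕ) [Fact p.Prime] (h5 : 5 ≤ p)
    (hs : (⟨0, 0, 0, -1, 0⟩ : WeierstrassCurve ℚ).HasSurjectiveModNGaloisRep p) :
    (⟨0, 0, 0, -1, 0⟩ : WeierstrassCurve ℚ).selmerCorank p ≤
      (⟨0, 0, 0, -1, 0⟩ : WeierstrassCurve ℚ).analyticRank :=
  absurd hs (tamePinch_not_hasSurjectiveModNGaloisRep_quartic (D := -1) (by norm_num) p (by omega))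

/-- **Read-back caveat made checkable: the typed sector is WIDER than "integral `j`".** A global
minimal model of `W121 = [0,−1,1,−40,−221]` has no prime of multiplicative reduction (its bad prime `11`
is additive, potentially multiplicative) although `j = −4096/11 ∉ ℤ`. Harmless for truth (§2: the wider
statement is still implied by BSD ∧ Ш-finite) but the docstring's gloss "(i.e. integral j)" is not what
the Lean says; the Heegner/definite dichotomy the planner has in mind is about MULTIPLICATIVE primes,
which is what the Lean states. [folklore] -/
theorem sector_wider_than_integral_j :
    ∃ (W : WeierstrassCurve ℚ) (_ : W.IsElliptic) (_ : W.IsGloballyMinimal),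
      (¬ ∃ (q : ℕ) (_ : Fact q.Prime), W.HasMultiplicativeReductionAtPrime q) ∧ ¬ ∃ n : ℤ, W.j = n := by
  obtain ⟨C, hC⟩ := WeierstrassCurve.hasGlobalMinimalModel_rat_holds CruxAttack.W121
  haveI := hC
  refine ⟨C • CruxAttack.W121, inferInstance, hC, ?_, ?_⟩
  · rintro ⟨q, hq, hm⟩
    exact CruxAttack.W121_not_hasMultiplicativeReductionAtPrime q
      ((hasMultiplicativeReductionAtPrime_smul_iff CruxAttack.W121 C q).mp hm)
  · rintro ⟨n, hn⟩
    rw [WeierstrassCurve.variableChange_j, CruxAttack.W121_j] at hn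
    have h11 : (11 : ℚ) * n = -4096 := by rw [← hn]; norm_num
    have h' : (11 * n : ℤ) = -4096 := by exact_mod_cast h11
    omega

/-! ### 2. Load-bearing analysis: no hypothesis is load-bearing for truth -/

/-- The hypothesis-free statement: `corank_p Sel_{p^∞}(W/ℚ) ≤ r_an(W)` for EVERY elliptic `W/ℚ` and
EVERY prime `p` (the upper half of Selmer-rank BSD). [folklore] -/
def UBBare : Prop :=
  ∀ (W : WeierstrassCurve ℚ) [W.IsElliptic] (p : ℕ) [Fact p.Prime], W.selmerCorank p ≤ W.analyticRank

/-- `C` without global minimality (ordinarity, which is typed through `frobeniusTrace` of the global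
minimal model, is dropped with it). [folklore] -/
def UBPotentiallyGoodWithoutMinimal : Prop :=
  ∀ (W : WeierstrassCurve ℚ) [W.IsElliptic],
    (¬ ∃ (q : ℕ) (_ : Fact q.Prime), W.HasMultiplicativeReductionAtPrime q) →
      ∀ (p : ℕ) [Fact p.Prime], 5 ≤ p → W.HasGoodReductionAtPrime p →
        W.HasSurjectiveModNGaloisRep p → W.selmerCorank p ≤ W.analyticRank

/-- `C` without the sector hypothesis. [folklore] -/
def UBPotentiallyGoodWithoutSector : Prop :=
  ∀ (W : WeierstrassCurve ℚ) [W.IsElliptic] [W.IsGloballyMinimal] (p : ℕ) [Fact p.Prime], 5 ≤ p →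
    W.HasGoodReductionAtPrime p → ¬ (p : ℤ) ∣ W.frobeniusTrace p → W.HasSurjectiveModNGaloisRep p →
      W.selmerCorank p ≤ W.analyticRank

/-- `C` without `5 ≤ p`. [folklore] -/
def UBPotentiallyGoodWithoutFive : Prop :=
  ∀ (W : WeierstrassCurve ℚ) [W.IsElliptic] [W.IsGloballyMinimal],
    (¬ ∃ (q : ℕ) (_ : Fact q.Prime), W.HasMultiplicativeReductionAtPrime q) →
      ∀ (p : ℕ) [Fact p.Prime], W.HasGoodReductionAtPrime p →
        ¬ (p : ℤ) ∣ W.frobeniusTrace p → W.HasSurjectiveModNGaloisRep p →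
          W.selmerCorank p ≤ W.analyticRank

/-- `C` without good reduction at `p`. [folklore] -/
def UBPotentiallyGoodWithoutGood : Prop :=
  ∀ (W : WeierstrassCurve ℚ) [W.IsElliptic] [W.IsGloballyMinimal],
    (¬ ∃ (q : ℕ) (_ : Fact q.Prime), W.HasMultiplicativeReductionAtPrime q) →
      ∀ (p : ℕ) [Fact p.Prime], 5 ≤ p →
        ¬ (p : ℤ) ∣ W.frobeniusTrace p → W.HasSurjectiveModNGaloisRep p →
          W.selmerCorank p ≤ W.analyticRank

/-- `C` without ordinarity at `p`. [folklore] -/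
def UBPotentiallyGoodWithoutOrdinary : Prop :=
  ∀ (W : WeierstrassCurve ℚ) [W.IsElliptic] [W.IsGloballyMinimal],
    (¬ ∃ (q : ℕ) (_ : Fact q.Prime), W.HasMultiplicativeReductionAtPrime q) →
      ∀ (p : ℕ) [Fact p.Prime], 5 ≤ p → W.HasGoodReductionAtPrime p →
        W.HasSurjectiveModNGaloisRep p → W.selmerCorank p ≤ W.analyticRank

/-- `C` without surjectivity of `ρ̄_{W,p}` (this variant DOES quantify over CM curves non-vacuously).
[folklore] -/
def UBPotentiallyGoodWithoutSurjective : Prop :=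
  ∀ (W : WeierstrassCurve ℚ) [W.IsElliptic] [W.IsGloballyMinimal],
    (¬ ∃ (q : ℕ) (_ : Fact q.Prime), W.HasMultiplicativeReductionAtPrime q) →
      ∀ (p : ℕ) [Fact p.Prime], 5 ≤ p → W.HasGoodReductionAtPrime p →
        ¬ (p : ℤ) ∣ W.frobeniusTrace p → W.selmerCorank p ≤ W.analyticRank

/-- Dropping the sector gives route SelmerRank's crux `SelmerRankUB` (stmt-0130) VERBATIM. [folklore] -/
theorem withoutSector_iff_selmerRankUB : UBPotentiallyGoodWithoutSector ↔ SelmerRank.SelmerRankUB :=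
  Iff.rfl

/-- **`BSD-rank ∧ SelmerRankShaPFinite ⟹ UBBare`** (Greenberg's PROVED identity
`corank Sel_{p^∞} = rank + corank Ш[p^∞]` and `corank Ш[p^∞] = 0` for finite `Ш[p^∞]`).
[cite: GreenbergLNM1716, §1] -/
theorem ubBare_of_bsd_of_shaPFinite (hS : _root_.BirchSwinnertonDyer)
    (hSha : FrozenTwin.SelmerRankShaPFinite) : UBBare := by
  intro W _ p _
  have h1 := W.selmerCorank_eq_mordellWeilRank_add_holds p
  have h2 : W.shaCorank p = 0 := Literature.BSD.shaCorank_eq_zero_of_finite W p (hSha W p)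
  have h3 : W.analyticRank = W.mordellWeilRank :=
    (show ∀ V : WeierstrassCurve ℚ, V.IsElliptic → V.analyticRank = V.mordellWeilRank from hS) W ‹_›
  omega

/-- `UBBare ⟹` each of the six weakenings (and `C`). [folklore] -/
theorem without_of_ubBare (h : UBBare) :
    UBPotentiallyGoodWithoutMinimal ∧ UBPotentiallyGoodWithoutSector ∧ UBPotentiallyGoodWithoutFive ∧
      UBPotentiallyGoodWithoutGood ∧ UBPotentiallyGoodWithoutOrdinary ∧
        UBPotentiallyGoodWithoutSurjective ∧ C :=
  ⟨fun W _ _ p _ _ _ _ => h W p, fun W _ _ p _ _ _ _ _ => h W p, fun W _ _ _ p _ _ _ _ => h W p,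
    fun W _ _ _ p _ _ _ _ => h W p, fun W _ _ _ p _ _ _ _ => h W p, fun W _ _ _ p _ _ _ _ => h W p,
    fun W _ _ _ p _ _ _ _ _ => h W p⟩

/-- Each weakening implies `C` (dropping a hypothesis only strengthens). [folklore] -/
theorem ub_of_without :
    (UBPotentiallyGoodWithoutMinimal → C) ∧ (UBPotentiallyGoodWithoutSector → C) ∧
      (UBPotentiallyGoodWithoutFive → C) ∧ (UBPotentiallyGoodWithoutGood → C) ∧
        (UBPotentiallyGoodWithoutOrdinary → C) ∧ (UBPotentiallyGoodWithoutSurjective → C) :=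
  ⟨fun h W _ _ hpg p _ h5 hg _ hs => h W hpg p h5 hg hs,
    fun h W _ _ _ p _ h5 hg ho hs => h W p h5 hg ho hs,
    fun h W _ _ hpg p _ _ hg ho hs => h W hpg p hg ho hs,
    fun h W _ _ hpg p _ h5 _ ho hs => h W hpg p h5 ho hs,
    fun h W _ _ hpg p _ h5 hg _ hs => h W hpg p h5 hg hs,
    fun h W _ _ hpg p _ h5 hg ho _ => h W hpg p h5 hg ho⟩

/-- **No `_false_without_<H>` theorem can exist** for any `H` among the six hypotheses (or for all of
them at once) short of refuting `BSD-rank ∧ Ш[p^∞]-finiteness`: a refutation of any weakening `X`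
with `UBBare → X` refutes the conjunction of the summit with item 0132. [cite: GreenbergLNM1716, §1] -/
theorem not_bsd_and_shaPFinite_of_not_without {X : Prop} (hX : UBBare → X) (h : ¬ X) :
    ¬ (_root_.BirchSwinnertonDyer ∧ FrozenTwin.SelmerRankShaPFinite) := fun hh =>
  h (hX (ubBare_of_bsd_of_shaPFinite hh.1 hh.2))

/-- In particular `¬ C` itself refutes `BSD-rank ∧ SelmerRankShaPFinite` (classically: `¬S ∨ ¬0132`).
[cite: GreenbergLNM1716, §1] -/
theorem not_summit_or_not_shaPFinite_of_not (h : ¬ C) :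
    ¬ _root_.BirchSwinnertonDyer ∨ ¬ FrozenTwin.SelmerRankShaPFinite := by
  by_contra hh
  push Not at hh
  exact not_bsd_and_shaPFinite_of_not_without (fun hb => (without_of_ubBare hb).2.2.2.2.2.2) h hh

/-- Converse bookkeeping (P3 of `Position.lean`, here through the route's own landed Serre supply
`frozenTwin_serrePrimeSupply_proof`): `C` gives the Mordell–Weil UPPER bound `rank ≤ r_an` for every
non-CM curve of the sector. [cite: Serre1972, §4.2 Thm 2] -/
theorem rank_le_analyticRank_of_ub (hC : C) (W : WeierstrassCurve ℚ) [W.IsElliptic]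
    [W.IsGloballyMinimal] (hW : ¬ W.HasCM)
    (hpg : ¬ ∃ (q : ℕ) (_ : Fact q.Prime), W.HasMultiplicativeReductionAtPrime q) :
    W.mordellWeilRank ≤ W.analyticRank := by
  obtain ⟨p, hp, h5, hgood, hord, hsurj⟩ := frozenTwin_serrePrimeSupply_proof W hW
  have h1 := W.selmerCorank_eq_mordellWeilRank_add_holds p
  have h2 := hC W hpg p h5 hgood hord hsurj
  omega

/-! ### 3. Shape of a counterexample -/

/-- **Tightness (b): the bound of `C` is attained wherever BSD-rank holds.** Unconditionally
`rank W ≤ corank_p Sel_{p^∞}(W)` (Kummer classes; the proved corank identity), so at any curve with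
`rank = r_an` one has `r_an ≤ corank_p`, and `C` there reads `corank_p = r_an`: the inequality cannot be
sharpened to `<` at any curve satisfying the summit, and modulo GZK it is an equality on the whole
`r_an ≤ 1` slice (`selmerCorank_eq_analyticRank_of_analyticRank_le_one`). [cite: GreenbergLNM1716, §1] -/
theorem analyticRank_le_selmerCorank_of_rank_eq (W : WeierstrassCurve ℚ) [W.IsElliptic] (p : ℕ)
    [Fact p.Prime] (h : W.mordellWeilRank = W.analyticRank) : W.analyticRank ≤ W.selmerCorank p := by
  have h1 := W.selmerCorank_eq_mordellWeilRank_add_holds p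
  omega

/-- So under `C`, BSD-rank at an admissible sector pair forces EQUALITY `corank_p = r_an` (and hence
`corank Ш(W)[p^∞] = 0`, P1'' of `Position.lean`). [cite: GreenbergLNM1716, §1] -/
theorem selmerCorank_eq_of_ub_of_rank_eq (hC : C) (W : WeierstrassCurve ℚ) [W.IsElliptic]
    [W.IsGloballyMinimal] (hpg : ¬ ∃ (q : ℕ) (_ : Fact q.Prime), W.HasMultiplicativeReductionAtPrime q)
    (p : ℕ) [Fact p.Prime] (h5 : 5 ≤ p) (hg : W.HasGoodReductionAtPrime p)
    (ho : ¬ (p : ℤ) ∣ W.frobeniusTrace p) (hs : W.HasSurjectiveModNGaloisRep p)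
    (h : W.mordellWeilRank = W.analyticRank) : W.selmerCorank p = W.analyticRank :=
  le_antisymm (hC W hpg p h5 hg ho hs) (analyticRank_le_selmerCorank_of_rank_eq W p h)

/-- **Unconditional dichotomy.** At a violating pair `(W,p)`, either BSD-rank fails at `W` by EXCESS
rank (`rank > r_an`) or `Ш(W)[p^∞]` has positive corank (only the proved corank identity is used).
[cite: GreenbergLNM1716, §1] -/
theorem cex_dichotomy (W : WeierstrassCurve ℚ) [W.IsElliptic] (p : ℕ) [Fact p.Prime]
    (h : ¬ W.selmerCorank p ≤ W.analyticRank) :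
    W.analyticRank < W.mordellWeilRank ∨ 1 ≤ W.shaCorank p := by
  have h1 := W.selmerCorank_eq_mordellWeilRank_add_holds p
  omega

/-- **Shape modulo Gross–Zagier–Kolyvagin and `p`-parity** (tree facts, as hypotheses): a violating
pair has `r_an ≥ 2` and `corank_p ≥ r_an + 2 ≥ 4`. So `C` is a theorem for `corank_p ≤ 3`, and the
first open cells are `(corank_p, r_an) ∈ {(4,2), (5,3), (6,2), (6,4), …}`.
[cite: Darmon2004, Thm. 3.22] [cite: DokchitserDokchitserAnnals2010, Thm. 1.4] -/
theorem cex_shape (hGZK : rank_eq_analyticRank_of_analyticRank_le_one)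
    (hPar : ∀ (W : WeierstrassCurve ℚ) [W.IsElliptic] (p : ℕ) [Fact p.Prime], selmerCorank_mod_two_eq W p)
    (W : WeierstrassCurve ℚ) [W.IsElliptic] (p : ℕ) [Fact p.Prime]
    (h : ¬ W.selmerCorank p ≤ W.analyticRank) :
    2 ≤ W.analyticRank ∧ W.analyticRank + 2 ≤ W.selmerCorank p ∧ 4 ≤ W.selmerCorank p := by
  have hr : 2 ≤ W.analyticRank := by
    by_contra hlt
    exact h (selmerCorank_eq_analyticRank_of_analyticRank_le_one hGZK W p (by omega)).le
  have hpar : W.selmerCorank p % 2 = W.analyticRank % 2 := hPar W p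
  refine ⟨hr, ?_, ?_⟩ <;> omega

/-- **Where BSD-rank is not violated by excess rank, `Ш` must be wild**: if `rank W ≤ r_an W` at a
violating pair (true under the summit, and throughout the LMFDB range where `rank = r_an` is
certified) then `corank Ш(W)[p^∞] ≥ 2`, i.e. `(ℚ_p/ℤ_p)² ⊆ Ш(W/ℚ)` — a phenomenon with no known
instance, heuristic or numerical signature. [cite: DokchitserDokchitserAnnals2010, Thm. 1.4] -/
theorem two_le_shaCorank_of_rank_le
    (hPar : ∀ (W : WeierstrassCurve ℚ) [W.IsElliptic] (p : ℕ) [Fact p.Prime], selmerCorank_mod_two_eq W p)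
    (W : WeierstrassCurve ℚ) [W.IsElliptic] (p : ℕ) [Fact p.Prime]
    (hrank : W.mordellWeilRank ≤ W.analyticRank) (h : ¬ W.selmerCorank p ≤ W.analyticRank) :
    2 ≤ W.shaCorank p := by
  have h1 := W.selmerCorank_eq_mordellWeilRank_add_holds p
  have hpar : W.selmerCorank p % 2 = W.analyticRank % 2 := hPar W p
  omega

/-- Under the summit `S` itself, `¬ C` pins an admissible pair with INFINITE `Ш(W)[p^∞]`
(corank ≥ 1 unconditionally in `S`; ≥ 2 with parity, above). [cite: GreenbergLNM1716, §1] -/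
theorem exists_infinite_sha_of_summit_of_not (hS : _root_.BirchSwinnertonDyer) (h : ¬ C) :
    ∃ (W : WeierstrassCurve ℚ) (_ : W.IsElliptic) (_ : W.IsGloballyMinimal) (p : ℕ) (_ : Fact p.Prime),
      (¬ ∃ (q : ℕ) (_ : Fact q.Prime), W.HasMultiplicativeReductionAtPrime q) ∧ 5 ≤ p ∧
        W.HasGoodReductionAtPrime p ∧ ¬ (p : ℤ) ∣ W.frobeniusTrace p ∧ W.HasSurjectiveModNGaloisRep p ∧
          1 ≤ W.shaCorank p ∧ ¬ Finite ↥(AddCommGroup.primaryComponent W.sha p) := by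
  by_contra hno
  apply h
  intro W _ _ hpg p _ h5 hg ho hs
  by_contra hlt
  have h1 := W.selmerCorank_eq_mordellWeilRank_add_holds p
  have h3 : W.analyticRank = W.mordellWeilRank :=
    (show ∀ V : WeierstrassCurve ℚ, V.IsElliptic → V.analyticRank = V.mordellWeilRank from hS) W ‹_›
  have hsha : 1 ≤ W.shaCorank p := by omega
  have hfin : ¬ Finite ↥(AddCommGroup.primaryComponent W.sha p) := by
    intro hfin
    have h2 : W.shaCorank p = 0 := Literature.BSD.shaCorank_eq_zero_of_finite W p hfin
    omega
  exact hno ⟨W, ‹_›, ‹_›, p, ‹_›, hpg, h5, hg, ho, hs, hsha, hfin⟩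

/-- **The Σ-shape of `¬ C`** (mod GZK + `p`-parity): a NON-CM sector curve in global minimal form, an
admissible prime `p ≥ 5`, with `r_an ≥ 2` and `corank_p ≥ r_an + 2 ≥ 4`. This is what any future
refuter (or kit certificate) has to exhibit. [cite: Darmon2004, Thm. 3.22]
[cite: DokchitserDokchitserAnnals2010, Thm. 1.4] -/
theorem exists_witness_of_not (hGZK : rank_eq_analyticRank_of_analyticRank_le_one)
    (hPar : ∀ (W : WeierstrassCurve ℚ) [W.IsElliptic] (p : ℕ) [Fact p.Prime], selmerCorank_mod_two_eq W p)
    (h : ¬ C) :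
    ∃ (W : WeierstrassCurve ℚ) (_ : W.IsElliptic) (_ : W.IsGloballyMinimal) (p : ℕ) (_ : Fact p.Prime),
      ¬ W.HasCM ∧ (¬ ∃ (q : ℕ) (_ : Fact q.Prime), W.HasMultiplicativeReductionAtPrime q) ∧ 5 ≤ p ∧
        W.HasGoodReductionAtPrime p ∧ ¬ (p : ℤ) ∣ W.frobeniusTrace p ∧ W.HasSurjectiveModNGaloisRep p ∧
          2 ≤ W.analyticRank ∧ W.analyticRank + 2 ≤ W.selmerCorank p ∧ 4 ≤ W.selmerCorank p := by
  by_contra hno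
  apply h
  rw [ubPotentiallyGood_iff_nonCM]
  intro W _ _ hCM hpg p _ h5 hg ho hs
  by_contra hlt
  obtain ⟨h2, h3, h4⟩ := cex_shape hGZK hPar W p hlt
  exact hno ⟨W, ‹_›, ‹_›, p, ‹_›, hCM, hpg, h5, hg, ho, hs, h2, h3, h4⟩

/-- **The open core.** Modulo Gross–Zagier–Kolyvagin, `C` is equivalent to its `r_an ≥ 2`, non-CM
slice. [cite: Darmon2004, Thm. 3.22] -/
theorem ubPotentiallyGood_iff_core (hGZK : rank_eq_analyticRank_of_analyticRank_le_one) :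
    C ↔ ∀ (W : WeierstrassCurve ℚ) [W.IsElliptic] [W.IsGloballyMinimal], ¬ W.HasCM →
      (¬ ∃ (q : ℕ) (_ : Fact q.Prime), W.HasMultiplicativeReductionAtPrime q) →
        ∀ (p : ℕ) [Fact p.Prime], 5 ≤ p → W.HasGoodReductionAtPrime p →
          ¬ (p : ℤ) ∣ W.frobeniusTrace p → W.HasSurjectiveModNGaloisRep p → 2 ≤ W.analyticRank →
            W.selmerCorank p ≤ W.analyticRank := by
  rw [ubPotentiallyGood_iff_nonCM]
  constructor
  · exact fun hC W _ _ hCM hpg p _ h5 hg ho hs _ => hC W hCM hpg p h5 hg ho hs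
  · intro hCore W _ _ hCM hpg p _ h5 hg ho hs
    by_cases hr : W.analyticRank ≤ 1
    · exact (selmerCorank_eq_analyticRank_of_analyticRank_le_one hGZK W p hr).le
    · exact hCore W hCM hpg p h5 hg ho hs (by omega)

/-! ### 4. Junk audit -/

/-- Selmer side: `zpCorank A p ≤ dim_{𝔽_p} A[p]` — the ℕ-subtraction can only LOWER the corank
(towards `C`). [folklore] -/
theorem zpCorank_le_finrank_torsionBy (A : Type*) [AddCommGroup A] (p : ℕ) :
    zpCorank A p ≤ (letI : Module (ZMod p) A[(p : ℤ)] := AddSubgroup.torsionBy.zmodModule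
      Module.finrank (ZMod p) A[(p : ℤ)]) :=
  Nat.sub_le _ _

/-- Selmer side: if `A[p]` is not finite-dimensional over `𝔽_p`, `finrank` is junk `0` and so is the
corank — again towards `C` (for `A = Sel_{p^∞}(W/ℚ)` this never happens: `Sel_p` is finite, and the
proved identity `corank Sel = rank + corank Ш` certifies honesty). [folklore] -/
theorem zpCorank_eq_zero_of_not_finite (A : Type*) [AddCommGroup A] (p : ℕ) [Fact p.Prime]
    (h : letI : Module (ZMod p) A[(p : ℤ)] := AddSubgroup.torsionBy.zmodModule
      ¬ Module.Finite (ZMod p) A[(p : ℤ)]) : zpCorank A p = 0 := by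
  letI : Module (ZMod p) A[(p : ℤ)] := AddSubgroup.torsionBy.zmodModule
  have h0 : Module.finrank (ZMod p) A[(p : ℤ)] = 0 := Module.finrank_of_not_finite h
  show Module.finrank (ZMod p) A[(p : ℤ)] - _ = 0
  rw [h0, Nat.zero_sub]

/-- Analytic side, junk case 1: if `W.entireLFunction` were NOT analytic at `1` (possible only when
`L(W,s)` has no entire continuation, the `dif` junk branch of `entireLFunction`), then
`analyticRank W = 0` — junk works AGAINST `C` (a positive-corank curve would violate it).
Excluded by modularity (`hasEntireLFunction_rat`, BCDT 2001 Thm A). [cite: BCDTJAMS2001, Theorem A] -/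
theorem analyticRank_eq_zero_of_not_analyticAt (W : WeierstrassCurve ℚ)
    (h : ¬ AnalyticAt ℂ W.entireLFunction 1) : W.analyticRank = 0 :=
  analyticOrderNatAt_of_not_analyticAt h

/-- Analytic side, junk case 2: if `L(W,s)` vanished identically near `s = 1`, `analyticOrderAt = ⊤`
and `analyticRank W = ⊤.toNat = 0` — again AGAINST `C`; excluded by `a₁ = 1`
(`entireLFunction_not_eventuallyEq_zero`). [cite: SilvermanAEC2009, App. C §16] -/
theorem analyticRank_eq_zero_of_eventuallyEq_zero (W : WeierstrassCurve ℚ)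
    (h : ∀ᶠ s in 𝓝 (1 : ℂ), W.entireLFunction s = 0) : W.analyticRank = 0 := by
  show (analyticOrderAt W.entireLFunction 1).toNat = 0
  rw [analyticOrderAt_eq_top.mpr h]
  rfl

/-- Under modularity the entire L-function is analytic at `1`. [cite: BCDTJAMS2001, Theorem A] -/
theorem analyticAt_entireLFunction_of_modularity (hE : hasEntireLFunction_rat)
    (W : WeierstrassCurve ℚ) [W.IsElliptic] : AnalyticAt ℂ W.entireLFunction 1 :=
  ((W.differentiable_entireLFunction (hE W)).analyticAt 1)

/-- **Honesty of `analyticRank` under the two printed facts**: with an entire continuation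
(modularity) that is not identically zero near `1` (`a₁ = 1`), `analyticRank W` is the genuine
(finite) order of vanishing `ord_{s=1} L(W,s)`. So the prover must invoke both facts, and the refuter
has no junk lever. [cite: BCDTJAMS2001, Theorem A] [cite: SilvermanAEC2009, App. C §16] -/
theorem analyticRank_honest (hE : hasEntireLFunction_rat) (W : WeierstrassCurve ℚ) [W.IsElliptic]
    (hNZ : W.entireLFunction_not_eventuallyEq_zero) :
    (W.analyticRank : ℕ∞) = analyticOrderAt W.entireLFunction 1 := by
  have hne : analyticOrderAt W.entireLFunction 1 ≠ ⊤ := by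
    rw [Ne, analyticOrderAt_eq_top]
    exact hNZ (hE W)
  exact ENat.coe_toNat hne

/-! ### 5. Natural strengthenings -/

/-- **FALSE strengthening (small model `32a2`)**: "every curve of the sector HAS an admissible prime
`p ≥ 5` (good ordinary, `ρ̄` onto)". The CM curve `32a2` is in the sector and has no odd surjective
prime. Hence the route's assembly can feed only NON-CM sector curves through `C` (as `closes` does,
via `SerrePrimeSupply`; CM curves go to `SelmerRankCM`). [cite: Serre1972, §4.5] -/
theorem strengthening_exists_admissible_false :
    ¬ ∀ (W : WeierstrassCurve ℚ) [W.IsElliptic] [W.IsGloballyMinimal],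
        (¬ ∃ (q : ℕ) (_ : Fact q.Prime), W.HasMultiplicativeReductionAtPrime q) →
          ∃ (p : ℕ) (_ : Fact p.Prime), 5 ≤ p ∧ W.HasGoodReductionAtPrime p ∧
            ¬ (p : ℤ) ∣ W.frobeniusTrace p ∧ W.HasSurjectiveModNGaloisRep p := by
  intro h
  obtain ⟨p, hp, h5, -, -, hsurj⟩ :=
    h ⟨0, 0, 0, -1, 0⟩ PGSelmerBSDNegative.thirtyTwoA2_no_multiplicative_prime
  exact tamePinch_not_hasSurjectiveModNGaloisRep_quartic (D := -1) (by norm_num) p (by omega) hsurj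

/-- The EQUALITY strengthening on the sector at admissible primes is exactly `C ∧ (SelmerRankLB`
restricted to the sector`)`; both halves follow from `BSD ∧ SelmerRankShaPFinite`, so it is not
refutable here either. [cite: GreenbergLNM1716, §1] -/
theorem strengthening_eq_of_bsd_of_shaPFinite (hS : _root_.BirchSwinnertonDyer)
    (hSha : FrozenTwin.SelmerRankShaPFinite) :
    ∀ (W : WeierstrassCurve ℚ) [W.IsElliptic] [W.IsGloballyMinimal],
      (¬ ∃ (q : ℕ) (_ : Fact q.Prime), W.HasMultiplicativeReductionAtPrime q) →
        ∀ (p : ℕ) [Fact p.Prime], 5 ≤ p → W.HasGoodReductionAtPrime p →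
          ¬ (p : ℤ) ∣ W.frobeniusTrace p → W.HasSurjectiveModNGaloisRep p →
            W.selmerCorank p = W.analyticRank := by
  intro W _ _ _ p _ _ _ _ _
  have h1 := W.selmerCorank_eq_mordellWeilRank_add_holds p
  have h2 : W.shaCorank p = 0 := Literature.BSD.shaCorank_eq_zero_of_finite W p (hSha W p)
  have h3 : W.analyticRank = W.mordellWeilRank :=
    (show ∀ V : WeierstrassCurve ℚ, V.IsElliptic → V.analyticRank = V.mordellWeilRank from hS) W ‹_›
  omega

/-- The STRICT strengthening `corank_p < r_an` reduces to exhibiting ONE admissible sector pair with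
`r_an = 0`: such a pair kills it outright (`corank < 0` is impossible). Not dischargeable in the tree
today (no certified `L(E,1) ≠ 0` for a named sector curve); recorded for a future seat. [folklore] -/
theorem strict_version_false_of_exists_analyticRank_zero
    (hex : ∃ (W : WeierstrassCurve ℚ) (_ : W.IsElliptic) (_ : W.IsGloballyMinimal) (p : ℕ)
      (_ : Fact p.Prime), (¬ ∃ (q : ℕ) (_ : Fact q.Prime), W.HasMultiplicativeReductionAtPrime q) ∧
        5 ≤ p ∧ W.HasGoodReductionAtPrime p ∧ ¬ (p : ℤ) ∣ W.frobeniusTrace p ∧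
          W.HasSurjectiveModNGaloisRep p ∧ W.analyticRank = 0) :
    ¬ ∀ (W : WeierstrassCurve ℚ) [W.IsElliptic] [W.IsGloballyMinimal],
        (¬ ∃ (q : ℕ) (_ : Fact q.Prime), W.HasMultiplicativeReductionAtPrime q) →
          ∀ (p : ℕ) [Fact p.Prime], 5 ≤ p → W.HasGoodReductionAtPrime p →
            ¬ (p : ℤ) ∣ W.frobeniusTrace p → W.HasSurjectiveModNGaloisRep p →
              W.selmerCorank p < W.analyticRank := by
  intro h
  obtain ⟨W, _, _, p, _, hpg, h5, hg, ho, hs, h0⟩ := hex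
  have := h W hpg p h5 hg ho hs
  omega

/-! ### 6. Targets / line notes -/

/-- `-- Targets`: none served (payload.targets = []; no PICKED line). `-- Lines` (pre-attack notes for
the lead, from reading `Lines/birth.lean` and `Lines/kurihara_depth.lean`): (i) `birth`: stubs
`stub_gzkRange` (= GZK slice, P4), `stub_modularity` (= `hasEntireLFunction_rat`), `stub_katoCorankBound`
(Kato 17.4: `corank_p ≤ ord_T L_p(W,T)` at admissible `p` — literature-true) and
`stub_padicOrderLeAnalyticRank` (ORD: `ord_T L_p ≤ r_an`, the order half of `p`-adic BSD — exactly as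
open as `C`; only numerically falsifiable by a pair with `ord_T L_p > r_an`, none for N ≤ 20000,
rattack j024435); joint sufficiency is genuine (Kato ∘ ORD), no smuggled gap; typing trap to watch:
an `ℕ∞`-valued `PowerSeries.order` with a junk-zero `L_p` makes `order = ⊤` and `⊤ ≤ ↑r_an` FALSE —
the stub must carry `L_p ≠ 0` (Rohrlich). (ii) `kurihara_depth`: `stub_newformUnitPeriod`
(`plusPeriod`/`ratPlusSymbol` pinned uniquely; junk `0` only if `re Λ_f` is not cyclic — excluded for
newforms), `stub_kimCorankBound` (Kim: `corank_p ≤` Kurihara-number depth — literature-true) and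
`stub_kuriharaDepthWitness` (WIT ⟺ `C` modulo Kim — as open as `C`). Neither line has a cheaply
false stub; both relocate the whole difficulty into one stub equivalent to the crux. (iii) By §1, both
lines may assume `¬ W.HasCM` throughout at no cost. [folklore] -/
theorem lineNotes : True := trivial

end Summit.BirchSwinnertonDyer.BirchSwinnertonDyer.Cruxes.UBPotentiallyGood.Disproof

end
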